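import Summits.BirchSwinnertonDyer.BirchSwinnertonDyer.Theorems.SylvesterTwoHeegnerIndexUpperOffV0DescentTwoSharpOfLeaves
import Summits.BirchSwinnertonDyer.BirchSwinnertonDyer.Theorems.SylvesterTwoHeegnerIndexUpperOffV0ShaBoundTwo
import HarnessLib

/-!
# K7t crux `UpperOffV0HSYPlus` (item 19804), line `offv0-kolyvagin2`: Kolyvagin at `p = 2` for
# `y² = x³ − c`, SHARP — `Ш(E/K)[2^∞]` killed by `2^{M₀+2}` from (d″) and the finset leaf (e_T)

Route `SylvesterTwoHeegnerIndex` (cell bsd-cm, rung K7t); stub (U1)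
`stub_shaTwoExponentSharpOffV0B_of_kolyvaginDescent_two` of the registered VARIANT E skeleton (planner
g22, D135).  The landed chain of this seat (`…DescentTwoOfLeaves` p470866 → `…ShaBoundTwo` p470927
→ … → `…KolyvaginTwoHSY`, `sha_two_primary_exponent_HSY_rat_of_poitouTate`) carries the generic
exponent `2^{2M₀+4}`.  SHARP twin of `…ShaBoundTwo`:

* `hdual₂_two_of_kolyvaginReciprocityFinsetM` — the two-place descent-form duality with defect one at
  `2` (leaf (B₂)) from the finset reciprocity (R_T)_M (`…UpperOffV0ReciprocityFinsetTwoOfPoitouTate`,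
  with `T = {λ'}`) through `lemma_5_3_descent_of_reciprocity_two` (p467003), which needs the
  reciprocity relation only for the pair `(s, d)` at `λ`;
* `sha_two_primary_exponent_sharp_of_pointsM_of_reciprocityFinsetM` — **`Ш(E/K)[2^∞]` finite and
  killed by `2^{M₀+2}`** granted (d″) (`hpoints`) and (e_T) (`hRT`; `T = ∅` is (e)), where
  `2^{M₀} ∥ y_K` in `E(K)` — via `descentTwoSharp_of_leaves` (`…UpperOffV0DescentTwoSharpOfLeaves`)
  at every level and Silverman X.4.2, as in p470927.

HONEST FRAMING.  Two powers of `2` above Kolyvagin's `C = 2^{M₀}` remain (`δ = 1` in McCallum's Lemma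
5.3 at `2`, intrinsic to `τ`-eigen Heegner classes, k7t-c2 g5 §5 / g7 ISOTROPY p494364; and the
eigen-decomposition).  Stub (U1) itself — `2^e Ш(E_p/ℚ)[2^∞] = 0` with `2e ≤ ord₂ #Ш_an(E_p)` — does
NOT follow: in a Heegner frame `2M₀ = ord₂ #Ш_an(E_p) + ord₂ #Ш_an(E_p^K) + 2t_K` (Gross–Zagier
against the two BSD formulae), so even this sharp exponent misses (U1) by `4 + ord₂ #Ш_an(E_p^K) +
2t_K ≥ 4` (seat memo K7T-UPPER-SHARP-k7t-c2-g8.md).  (e_T) rests on Poitou–Tate exactly like (e).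
No named fact, no definition, no `sorry`; B14 = O12 open as a class; BSD not claimed.
-/

noncomputable section

open scoped Classical
open WeierstrassCurve NumberField IsDedekindDomain Field Literature.NumberTheory.EllipticCurves
  Literature.NumberTheory.GaloisRepresentations Literature.NumberTheory.EllipticCurves.KolyvaginDescent

set_option autoImplicit false
set_option linter.dupNamespace false

namespace Summit.BirchSwinnertonDyer.BirchSwinnertonDyer.Theorems.SylvesterTwoUpper

universe u

section Sha

variable {N : ℕ} [NeZero N] (W : WeierstrassCurve ℚ) {K : Type u} [Field K] [NumberField K]

/-- **Leaf (B₂) at `p = 2` with defect one — the two-place descent-form duality — from the finset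
reciprocity (R_T)_M** (`…UpperOffV0ReciprocityFinsetTwoOfPoitouTate`): for a Heegner point `P` of
level `N` (good reduction at the Kolyvagin primes), `M ≥ 1`, and (R_T)_M at every Kolyvagin prime of
level `M` at `2` — the shape of the leaf (e_T) — the two-place descent form
`2^a d_λ ≠ 0 ⟹ 2^{M-1-a+1} s_λ = 0` for a `ν`-eigenclass `d` Selmer off `{λ, λ'}` and a Selmer
`ν`-eigenclass `s` vanishing at `λ'`: (R_T)_M with `T = {λ'}` feeds `lemma_5_3_descent_of_reciprocity_two`
(p467003), which only needs the reciprocity relation for the pair `(s, d)` at `λ`.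
[cite: McCallumLMS1991, §2 Prop. 2.2, §5 Lemma 5.3 and proof of Prop. 5.2] -/
theorem hdual₂_two_of_kolyvaginReciprocityFinsetM [W.IsElliptic] (hK : IsImaginaryQuadratic K)
    {C : VariableChange ℚ} {cM : ℚ} (hCW : C • W = ⟨0, 0, 0, 0, -cM⟩)
    {P : (W.baseChange K).toAffine.Point} (hP : IsHeegnerPoint N W K P) {M : ℕ} (hM : 1 ≤ M)
    {c : K ≃ₐ[ℚ] K} (hc : c ≠ 1)
    (hRT : ∀ {ℓ : ℕ} (hℓ : IsKolyvaginPrime N W K 2 ℓ), FrobEqFrobInfty W K (2 ^ M) ℓ →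
      ∃ (A : Type u) (_ : AddCommGroup A)
        (e : geomTorsion (W.baseChange K) ((2 ^ M : ℕ) : ℤ) →+
          geomTorsion (W.baseChange K) ((2 ^ M : ℕ) : ℤ) →+ A),
        (∀ x, e x x = 0) ∧ (∀ x, (∀ y, e x y = 0) → x = 0) ∧
        ∀ (T : Finset (HeightOneSpectrum (𝓞 K))),
        ∀ s ∈ selmerGroup (W.baseChange K) ((2 ^ M : ℕ) : ℤ),
          (∀ v ∈ T, s ∈ (W.baseChange K).torsionLocalKer (v.adicCompletion K) ((2 ^ M : ℕ) : ℤ)) →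
          ∀ c' : galH1Torsion (W.baseChange K) ((2 ^ M : ℕ) : ℤ),
          (∀ v : HeightOneSpectrum (𝓞 K), v ∉ T → (ℓ : 𝓞 K) ∉ v.asIdeal →
            c' ∈ selmerLocalKer (W.baseChange K) (v.adicCompletion K) ((2 ^ M : ℕ) : ℤ)) →
          (∀ w : InfinitePlace K,
            c' ∈ selmerLocalKer (W.baseChange K) w.Completion ((2 ^ M : ℕ) : ℤ)) →
          ∀ 𝔔 ∈ hℓ.place.primesAbove, ∀ F : absoluteGaloisGroup K, IsArithFrobAt (𝓞 K) F 𝔔 →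
            F ∈ torsionFixing (W.baseChange K) ((2 ^ M : ℕ) : ℤ) →
            ∀ σ ∈ 𝔔.inertia (absoluteGaloisGroup K),
            e (h1Eval (W.baseChange K) ((2 ^ M : ℕ) : ℤ) s F)
              (h1Eval (W.baseChange K) ((2 ^ M : ℕ) : ℤ) c' σ) = 0) :
    ∀ ℓ ℓ' : ℕ, IsKolyvaginPrime N W K 2 ℓ ∧ FrobEqFrobInfty W K (2 ^ M) ℓ →
      IsKolyvaginPrime N W K 2 ℓ' ∧ FrobEqFrobInfty W K (2 ^ M) ℓ' → ℓ ≠ ℓ' →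
      ∀ ν : ℤ, (ν = 1 ∨ ν = -1) → ∀ d : galH1Torsion (W.baseChange K) ((2 ^ M : ℕ) : ℤ),
      conjAct W c _ d = ν • d →
      (∀ v : HeightOneSpectrum (𝓞 K), (ℓ : 𝓞 K) ∉ v.asIdeal → (ℓ' : 𝓞 K) ∉ v.asIdeal →
        d ∈ selmerLocalKer (W.baseChange K) (v.adicCompletion K) ((2 ^ M : ℕ) : ℤ)) →
      (∀ w : InfinitePlace K, d ∈ selmerLocalKer (W.baseChange K) w.Completion ((2 ^ M : ℕ) : ℤ)) →
      ∀ s ∈ selmerGroup (W.baseChange K) ((2 ^ M : ℕ) : ℤ), conjAct W c _ s = ν • s →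
      (∀ v : HeightOneSpectrum (𝓞 K), (ℓ' : 𝓞 K) ∈ v.asIdeal →
        s ∈ (W.baseChange K).torsionLocalKer (v.adicCompletion K) ((2 ^ M : ℕ) : ℤ)) →
      ∀ a : ℕ, a < M → ∀ v : HeightOneSpectrum (𝓞 K), (ℓ : 𝓞 K) ∈ v.asIdeal →
        (((2 : ℕ) : ℤ) ^ a) • d ∉
          selmerLocalKer (W.baseChange K) (v.adicCompletion K) ((2 ^ M : ℕ) : ℤ) →
        (((2 : ℕ) : ℤ) ^ (M - 1 - a + 1)) • s ∈
          (W.baseChange K).torsionLocalKer (v.adicCompletion K) ((2 ^ M : ℕ) : ℤ) := by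
  intro ℓ ℓ' hℓ hℓ' _hne ν hν d hd hfin hinf s hs hτs hsT a ha v hv hdv
  have hvw : v = hℓ.1.place := hℓ.1.mem_iff.mp hv
  subst hvw
  have hgood : (W.baseChange K).HasGoodReductionAt hℓ.1.place := by
    have h := IsKolyvaginPrime.not_mem_badPlaces (W := W) hP hℓ.1
    rwa [WeierstrassCurve.mem_badPlaces_iff, not_not] at h
  obtain ⟨A, _, e, halt, hnd, hRe⟩ := hRT hℓ.1 hℓ.2
  rw [show M - 1 - a + 1 = M - a by omega]
  refine lemma_5_3_descent_of_reciprocity_two W hK hCW hc hℓ.1 hM rfl hℓ.2 hgood e halt hnd hν hd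
    hdv hs hτs (fun 𝔔 h𝔔 F hF hFT σ hσ ↦ hRe {hℓ'.1.place} s hs ?_ d ?_ hinf 𝔔 h𝔔 F hF hFT σ hσ)
  · intro v' hv'
    rw [Finset.mem_singleton] at hv'
    subst hv'
    exact hsT _ hℓ'.1.mem_place
  · intro v' hv'T hv'ℓ
    refine hfin v' hv'ℓ (fun h ↦ hv'T ?_)
    rw [Finset.mem_singleton]
    exact hℓ'.1.mem_iff.mp h

/-- **Kolyvagin's theorem at `p = 2` for `y² = x³ − c`, exponent form, SHARP: `Ш(E/K)[2^∞]` is finite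
and killed by `2^{M₀+2}`**, for a `ℚ`-model `W` of `y² = x³ − c` over an imaginary quadratic `K` with
`∛c ∉ K`, `ω ∉ K`, `E(K)[2] = 0`, and a Heegner point `P = y_K` of level `N` of infinite order, GRANTED
— at every level `2^M` and for the complex conjugation `c` — Heegner-type points with their signs and
local properties (`hpoints`, the shape of stub (d″)) and the FINSET reciprocity (R_T)_M (`hRT`, the
shape of the leaf (e_T); `T = ∅` is stub (e)).  `2^{M₀}` is the exact power of `2` dividing `P` in
`E(K)` (McCallum Lemma 5.1).  Chain: `exists_leafA_of_points` → `hdual_two_of_kolyvaginReciprocityM`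
(one place, `T = ∅`) + `hdual₂_two_of_kolyvaginReciprocityFinsetM` (two places) →
`descentTwoSharp_of_leaves` (`2·2^{M₀+1} S_{2^j}(E/K) ⊆ ℤ δ_j x₀`, every `j ≥ 1`) → Silverman X.4.2.
The landed `sha_two_primary_exponent_of_pointsM_of_reciprocityM` (p470927) gives `2^{2M₀+4}` from
(d″)+(e); the odd-`p` original gives `p^{2M₀}` (`HypothesesM`) resp. Kolyvagin's `p^{M₀}`
(`…AnnihilatorProofs`); the `+2` here is the 2-adic defect (Lemma 5.3 at `2` once, decomposition once).
[cite: McCallumLMS1991, §1 Theorem (Kolyvagin), §2 Prop. 2.2, §§3–5] [cite: GrossLMS1991, Thm. 1.3 (2), §10]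
[cite: SilvermanAEC2009, Thm X.4.2] -/
theorem sha_two_primary_exponent_sharp_of_pointsM_of_reciprocityFinsetM [W.IsElliptic]
    (hK : IsImaginaryQuadratic K)
    {C : VariableChange ℚ} {cM : ℚ} (hCW : C • W = ⟨0, 0, 0, 0, -cM⟩)
    (hcube : ∀ x : K, x ^ 3 ≠ (cM : K)) (hωK : ∀ x : K, x ^ 2 + x + 1 ≠ 0)
    (hA2 : ∀ a : (W.baseChange K).toAffine.Point, 2 • a = 0 → a = 0)
    {P : (W.baseChange K).toAffine.Point} (hP : IsHeegnerPoint N W K P) (hnt : ¬ IsOfFinAddOrder P)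
    (hpoints : ∀ {M : ℕ} (_hM : 1 ≤ M)
      (hdiv : ∀ Q : geomPoints (W.baseChange K), ∃ R, ((2 ^ M : ℕ) : ℤ) • R = Q)
      (c : K ≃ₐ[ℚ] K) (_hc : c ≠ 1),
      ∃ (ε : ℤ) (τ : AlgebraicClosure K ≃+* AlgebraicClosure K) (hτ : IsLiftOfAut c τ)
        (A : ℕ → AddSubgroup (geomPoints (W.baseChange K)))
        (hA : ∀ m, KolyvaginCocycle.IsAdmissible (Field.absoluteGaloisGroup K) (A m)
          ((2 ^ M : ℕ) : ℤ))
        (Pt : ℕ → geomPoints (W.baseChange K))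
        (hPt : ∀ m, Pt m ∈
          KolyvaginCocycle.invPoints (Field.absoluteGaloisGroup K) (A m) ((2 ^ M : ℕ) : ℤ)),
        (ε = 1 ∨ ε = -1) ∧
        IsOfFinAddOrder (Affine.Point.map (W' := W) (c : K →ₐ[ℚ] K) P - ε • P) ∧
        (∀ m, ∀ a ∈ A m, hτ.pointsMap W a ∈ A m) ∧
        Pt 1 = toGeomPoints (W.baseChange K) P ∧
        (∀ m : ℕ, Squarefree m →
          (∀ q ∈ m.primeFactors, IsKolyvaginPrime N W K 2 q ∧ FrobEqFrobInfty W K (2 ^ M) q) →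
          (∃ B ∈ A m, hτ.pointsMap W (Pt m) =
            (ε * (-1) ^ m.primeFactors.card) • Pt m + ((2 ^ M : ℕ) : ℤ) • B) ∧
          (∀ v : HeightOneSpectrum (𝓞 K), (m : 𝓞 K) ∉ v.asIdeal →
            kolyvaginClass (W.baseChange K) _ hdiv (hA m) (Pt m) (hPt m) ∈
              selmerLocalKer (W.baseChange K) (v.adicCompletion K) ((2 ^ M : ℕ) : ℤ)) ∧
          (∀ ℓ : ℕ, ℓ.Prime → ℓ ∣ m → ∀ v : HeightOneSpectrum (𝓞 K), (ℓ : 𝓞 K) ∈ v.asIdeal →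
            ∀ a : ℕ, ((((2 : ℕ) : ℤ) ^ a) •
                kolyvaginClass (W.baseChange K) _ hdiv (hA m) (Pt m) (hPt m) ∈
                selmerLocalKer (W.baseChange K) (v.adicCompletion K) ((2 ^ M : ℕ) : ℤ) ↔
              (((2 : ℕ) : ℤ) ^ a) • kolyvaginClass (W.baseChange K) _ hdiv (hA (m / ℓ)) (Pt (m / ℓ))
                  (hPt (m / ℓ)) ∈
                (W.baseChange K).torsionLocalKer (v.adicCompletion K) ((2 ^ M : ℕ) : ℤ)))))
    (hRT : ∀ {M : ℕ} (_hM : 1 ≤ M) {ℓ : ℕ} (hℓ : IsKolyvaginPrime N W K 2 ℓ),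
      FrobEqFrobInfty W K (2 ^ M) ℓ →
      ∃ (A : Type u) (_ : AddCommGroup A)
        (e : geomTorsion (W.baseChange K) ((2 ^ M : ℕ) : ℤ) →+
          geomTorsion (W.baseChange K) ((2 ^ M : ℕ) : ℤ) →+ A),
        (∀ x, e x x = 0) ∧ (∀ x, (∀ y, e x y = 0) → x = 0) ∧
        ∀ (T : Finset (HeightOneSpectrum (𝓞 K))),
        ∀ s ∈ selmerGroup (W.baseChange K) ((2 ^ M : ℕ) : ℤ),
          (∀ v ∈ T, s ∈ (W.baseChange K).torsionLocalKer (v.adicCompletion K) ((2 ^ M : ℕ) : ℤ)) →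
          ∀ c' : galH1Torsion (W.baseChange K) ((2 ^ M : ℕ) : ℤ),
          (∀ v : HeightOneSpectrum (𝓞 K), v ∉ T → (ℓ : 𝓞 K) ∉ v.asIdeal →
            c' ∈ selmerLocalKer (W.baseChange K) (v.adicCompletion K) ((2 ^ M : ℕ) : ℤ)) →
          (∀ w : InfinitePlace K,
            c' ∈ selmerLocalKer (W.baseChange K) w.Completion ((2 ^ M : ℕ) : ℤ)) →
          ∀ 𝔔 ∈ hℓ.place.primesAbove, ∀ F : Field.absoluteGaloisGroup K,
            IsArithFrobAt (𝓞 K) F 𝔔 →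
            F ∈ torsionFixing (W.baseChange K) ((2 ^ M : ℕ) : ℤ) →
            ∀ σ ∈ 𝔔.inertia (Field.absoluteGaloisGroup K),
            e (h1Eval (W.baseChange K) ((2 ^ M : ℕ) : ℤ) s F)
              (h1Eval (W.baseChange K) ((2 ^ M : ℕ) : ℤ) c' σ) = 0) :
    ∃ (M₀ : ℕ) (x₀ : (W.baseChange K).toAffine.Point),
      2 ^ M₀ • x₀ = P ∧ (∀ Q : (W.baseChange K).toAffine.Point, 2 ^ (M₀ + 1) • Q ≠ P) ∧
      (∀ cs : (W.baseChange K).sha, (∃ j : ℕ, 2 ^ j • cs = 0) → 2 ^ (M₀ + 2) • cs = 0) ∧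
      Set.Finite {cs : (W.baseChange K).sha | ∃ j : ℕ, 2 ^ j • cs = 0} := by
  haveI : (W.baseChange K).IsElliptic := inferInstanceAs (W.map (algebraMap ℚ K)).IsElliptic
  obtain ⟨c, hc, hcc⟩ := exists_conj_of_isImaginaryQuadratic K hK
  -- `M₀`, `x₀` (McCallum Lemma 5.1, using `E(K)[2] = 0`)
  obtain ⟨M₀, x₀, hx₀, hmax, hgen⟩ :=
    exists_kummer_generator_pow (W.baseChange K) Nat.prime_two hA2 hnt
  have hdivj : ∀ j : ℕ, ∀ Q : geomPoints (W.baseChange K), ∃ R, ((2 ^ j : ℕ) : ℤ) • R = Q :=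
    fun j ↦ (W.baseChange K).zsmul_geomPoints_surjective_holds
      (by exact_mod_cast pow_ne_zero j two_ne_zero)
  -- (R)_M (one place) = (R_T)_M with `T = ∅`
  have hR : ∀ {M : ℕ} (_hM : 1 ≤ M) {ℓ : ℕ} (hℓ : IsKolyvaginPrime N W K 2 ℓ),
      FrobEqFrobInfty W K (2 ^ M) ℓ →
      ∃ (A : Type u) (_ : AddCommGroup A)
        (e : geomTorsion (W.baseChange K) ((2 ^ M : ℕ) : ℤ) →+
          geomTorsion (W.baseChange K) ((2 ^ M : ℕ) : ℤ) →+ A),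
        (∀ x, e x x = 0) ∧ (∀ x, (∀ y, e x y = 0) → x = 0) ∧
        ∀ s ∈ selmerGroup (W.baseChange K) ((2 ^ M : ℕ) : ℤ),
          ∀ c' : galH1Torsion (W.baseChange K) ((2 ^ M : ℕ) : ℤ),
          (∀ v : HeightOneSpectrum (𝓞 K), (ℓ : 𝓞 K) ∉ v.asIdeal →
            c' ∈ selmerLocalKer (W.baseChange K) (v.adicCompletion K) ((2 ^ M : ℕ) : ℤ)) →
          (∀ w : InfinitePlace K,
            c' ∈ selmerLocalKer (W.baseChange K) w.Completion ((2 ^ M : ℕ) : ℤ)) →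
          ∀ 𝔔 ∈ hℓ.place.primesAbove, ∀ F : Field.absoluteGaloisGroup K,
            IsArithFrobAt (𝓞 K) F 𝔔 →
            F ∈ torsionFixing (W.baseChange K) ((2 ^ M : ℕ) : ℤ) →
            ∀ σ ∈ 𝔔.inertia (Field.absoluteGaloisGroup K),
            e (h1Eval (W.baseChange K) ((2 ^ M : ℕ) : ℤ) s F)
              (h1Eval (W.baseChange K) ((2 ^ M : ℕ) : ℤ) c' σ) = 0 := by
    intro M hM ℓ hℓ hℓM
    obtain ⟨A, _, e, halt, hnd, h⟩ := hRT hM hℓ hℓM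
    exact ⟨A, inferInstance, e, halt, hnd, fun s hs c' hc'fin hc'inf 𝔔 h𝔔 F hF hFfix σ hσ ↦
      h ∅ s hs (fun v hv ↦ absurd hv (Finset.notMem_empty v)) c' (fun v _ hv ↦ hc'fin v hv) hc'inf 𝔔
        h𝔔 F hF hFfix σ hσ⟩
  -- the SHARP descent at every level `2^j`, `j ≥ 1`
  have key : ∀ j : ℕ, 1 ≤ j → ∀ s ∈ selmerGroup (W.baseChange K) ((2 ^ j : ℕ) : ℤ),
      (2 * ((2 : ℕ) : ℤ) ^ (M₀ + 1)) • s ∈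
        AddSubgroup.zmultiples (kummerMapTorsion (W.baseChange K) _ (hdivj j) x₀) := by
    intro j hj s hs
    obtain ⟨ε, τ, hτ, A, hA, Pt, hPt, hε, h53, hAτ, hPt1, hm⟩ := hpoints hj (hdivj j) c hc
    obtain ⟨cl, hc1, hcl⟩ := exists_leafA_of_points (N := N) (hdivj j) c hτ ε A hA hAτ Pt hPt hPt1
      (fun m hm' hk ↦ (hm m hm' hk).1) (fun m hm' hk ↦ (hm m hm' hk).2.1)
      (fun m hm' hk ↦ (hm m hm' hk).2.2)
    obtain ⟨hPx, hxord⟩ := hgen j (by omega) (hdivj j)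
    exact descentTwoSharp_of_leaves (N := N) hK hCW hcube hωK hj (hdivj j) hc hcc hA2 hx₀ hPx hxord
      ε hε h53 cl hc1 hcl
      (hdual_two_of_kolyvaginReciprocityM W hK hCW hP hj hc (fun hℓ hℓM ↦ hR hj hℓ hℓM))
      (hdual₂_two_of_kolyvaginReciprocityFinsetM W hK hCW hP hj hc (fun hℓ hℓM ↦ hRT hj hℓ hℓM)) hs
  -- passage to `Ш(E/K)[2^∞]` (Silverman X.4.2)
  have hkill : ∀ cs : (W.baseChange K).sha, (∃ j : ℕ, 2 ^ j • cs = 0) →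
      2 ^ (M₀ + 2) • cs = 0 := by
    rintro cs ⟨j, hj⟩
    set j' := max j 1 with hj'def
    have hj₁ : 1 ≤ j' := le_max_right _ _
    have hj' : 2 ^ j' • cs = 0 := by
      have : j' = (j' - j) + j := by omega
      rw [this, pow_add, mul_smul, hj, smul_zero]
    have hn : ((2 ^ j' : ℕ) : ℤ) ≠ 0 := by exact_mod_cast pow_ne_zero j' two_ne_zero
    have hc' : (cs : (W.baseChange K).galH1) ∈ (W.baseChange K).sha ⊓
        AddSubgroup.torsionBy (W.baseChange K).galH1 ((2 ^ j' : ℕ) : ℤ) := by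
      refine AddSubgroup.mem_inf.mpr ⟨cs.2, ?_⟩
      rw [mem_torsionBy_iff, natCast_zsmul, ← AddSubgroupClass.coe_nsmul, hj', ZeroMemClass.coe_zero]
    rw [← (W.baseChange K).map_torsionH1ToH1_selmerGroup_holds hn, AddSubgroup.mem_map] at hc'
    obtain ⟨s, hs, hts⟩ := hc'
    have hmem := key j' hj₁ s hs
    have hker : AddSubgroup.zmultiples (kummerMapTorsion (W.baseChange K) _ (hdivj j') x₀) ≤
        (torsionH1ToH1 (W.baseChange K) ((2 ^ j' : ℕ) : ℤ)).ker :=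
      AddSubgroup.zmultiples_le_of_mem (by
        rw [AddMonoidHom.mem_ker]
        exact torsionH1ToH1_kummerMapTorsion _ _ _ x₀)
    have h0 : torsionH1ToH1 (W.baseChange K) ((2 ^ j' : ℕ) : ℤ)
        ((2 * ((2 : ℕ) : ℤ) ^ (M₀ + 1)) • s) = 0 :=
      (AddMonoidHom.mem_ker).mp (hker hmem)
    rw [map_zsmul, hts] at h0
    apply Subtype.ext
    rw [AddSubgroupClass.coe_nsmul, ZeroMemClass.coe_zero, ← natCast_zsmul]
    have hcast : ((2 ^ (M₀ + 2) : ℕ) : ℤ) = 2 * ((2 : ℕ) : ℤ) ^ (M₀ + 1) := by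
      push_cast
      ring
    rw [hcast]
    exact h0
  exact ⟨M₀, x₀, hx₀, hmax, hkill,
    (W.baseChange K).finite_sha_primary_of_pow_smul_eq_zero two_ne_zero hkill⟩


end Sha

end Summit.BirchSwinnertonDyer.BirchSwinnertonDyer.Theorems.SylvesterTwoUpper

end
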